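import Literature.Analysis.FluidPDE.TaoH1AlmostRegularForcedAssembly
import Literature.Analysis.FluidPDE.TaoSmoothExistenceForcedFullSlab
import Literature.Analysis.FluidPDE.TaoH1LocalExistenceForcedHolds
import HarnessLib

/-!
# Tao 2013, Theorem 5.4 WITH FORCE is a theorem of the tree:
# `tao2011_forced_H1_local_almost_regular_holds`

Analysis/FluidPDE proof file (cell `pub/ns-blowup`, seat `ns-blowup-lit` g11; one theorem, no
definitions, no named facts; net Literature debt −1). The named fact
`tao2011_forced_H1_local_almost_regular` (`TaoH1AlmostRegularForced.lean`: Tao 2013, Thm. 5.4 =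
arXiv:1108.1165 Thm. 31 (i)–(iv) with Lemma 5.5, for the Navier–Stokes system driven by a Clay-class
force `f` — smooth on `[0, ∞) × ℝ³` with Fefferman's decay (5)) is discharged by the chain
«p428734 ⇐ F2» of the cell:

* F2 = `tao2011_smooth_local_existence_forced_holds` (`TaoH1LocalExistenceForcedHolds`: smooth local
  existence with force by the forced Fourier–Picard scheme; lean2 g3),
* P5 = `smooth_existence_forced_fullSlab` (`TaoSmoothExistenceForcedFullSlab`: F2 iterated to the
  printed lifespan `(‖u₀‖_{H¹} + ‖f‖_{L¹_t H¹_x})⁴ T ≤ c ν³` through the forced enstrophy a priori bound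
  `exists_leray_enstrophy_apriori_forced` of `LerayEnstrophyAPrioriForced` (P1), Tao's forced energy
  bound, glue and uniqueness in Tao's class; lit g11),
* P6 = `tao2011_forced_H1_local_almost_regular_of_fullSlab` (`TaoH1AlmostRegularForcedAssembly`:
  mollified data, the uniform bounds P1/P2 = `tao2011_quantitative_regularity_forced` (lean g8), the
  `L²` stability P3 = `exists_l2_stability_forced` and the Leray–Hopf limit P4 =
  `exists_isLerayHopfOn_of_uniform_cauchy_forced` (lean2 g4), the forced restart
  `exists_classical_rep_of_restart_clayForce` (lean g8) and forced weak–strong uniqueness; lean2 g4).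

Consequences made unconditional elsewhere: the T23 («Sohr corner») theorems of
`NSSerrinRegularityForced` / `LerayH1ContinuationForced` (`…_of_tao`), see
`NSSerrinRegularityForcedHolds`.

WHAT THIS IS NOT: not a statement about Navier–Stokes blow-up or global regularity — the classical
`H¹` LOCAL theory with a Schwartz force (local existence, positive-time smoothness, Leray–Hopf
energy class) for GIVEN data; no flow, stage, tower or blow-up is constructed.

## References
* T. Tao, Localisation and compactness properties of the Navier–Stokes global regularity problem,
  Anal. PDE 6 (2013) 25–107 = arXiv:1108.1165; Thm. 5.4 (i)–(iv), Lemma 5.5, §5. [cite: Tao2011, Thm. 5.4]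
* C. L. Fefferman, Existence and smoothness of the Navier–Stokes equation (Clay, 2006), (5)–(6).
  [cite: FeffermanClay2006, (5)-(6)]
-/

noncomputable section

namespace Literature.Analysis.FluidPDE

/-- **Tao 2013, Theorem 5.4 with a Clay-class force (the `H¹` local theory: Leray–Hopf solution on
the printed lifespan `(‖u₀‖_{H¹} + ‖f‖_{L¹_t H¹_x})⁴ T ≤ c ν³`, `H¹`-regular on `[0, T]`, smooth in
Tao's class on every `[τ, T]`, `τ > 0`) holds**: the named fact
`tao2011_forced_H1_local_almost_regular` is a theorem of the tree (F2 → P5 → P6).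
[cite: Tao2011, Thm. 5.4 (i)-(iv) with Lemma 5.5] -/
theorem tao2011_forced_H1_local_almost_regular_holds : tao2011_forced_H1_local_almost_regular :=
  tao2011_forced_H1_local_almost_regular_of_fullSlab
    (smooth_existence_forced_fullSlab tao2011_smooth_local_existence_forced_holds)

end Literature.Analysis.FluidPDE

end
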